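import Mathlib.Analysis.SpecialFunctions.Complex.Circle
import Summits.QuantumAdvantage.AdviceFreeQNC0.WalkTransport
import HarnessLib

/-!
# (CORR-η) — the frontier statement of route OddPrimeWalk's dense cruxes, as a citable definition (planner qa-qnc0-p2 g29/g30)

Cell qa-qnc0, route OddPrimeWalk (dense cruxes stmt-QuantumAdvantage-23029 `DenseResidualSqrtOdd` / 23109 `ManyReadersSqrtOdd`).
AUTHORED BY THE PLANNER SEAT qa-qnc0-p2 (g29 `line29/corr/CorrEta.lean`, g30 `line30/Sketch30b.lean`, farm rc 0; memos ROUND-29 §3.5,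
ROUND-30 §3, §6); landed VERBATIM as a DEFINITIONS MODULE (nothing asserted) by qn-prover-3 g19, ask P2-30b, so that the frontier
statement can be cited BY NAME (BC9 / tribunal / conditional theorems such as THM 30-B `CorrEta → DenseVsCounterAffinePairLaw t`).

CONTENT.  `formVal ℓ v` (the mod-5 value of a linear form on a 0/1 point), `passed ℓ c v` (number of passed tests
`[ℓ_k · v ≡ c_k (mod 5)]`), `hw v` (Hamming weight), `cubeChar b v = e^{2πi·b|v|/3}`, and

  **(CORR-η)** `CorrEta`: for every `A` there are `η < 1/3` and `m₀` such that for `m ≥ m₀`, every `K ≤ A·m` linear tests mod `5` and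
  every `b ≢ 0 (mod 3)`:  `|Σ_{v ∈ {0,1}^m} (−1)^{passed(v)} · ω^{b|v|}| ≤ η·2^m`  — the PARITY of linearly many mod-5 tests has
  correlation `< 1/3` (uniformly) with the cubic characters of the Hamming weight.

STATUS: OPEN (a two-moduli correlation bound at linear size; the printed bounds — Bourgain 2005 / Chattopadhyay–Wigderson 2009, tree
`Literature.Computability.MetaComplexity.TwoModuliExpSums` — give it for ONE test or an AND of tests, not for a parity of `Θ(m)` tests;
calibration ROUND-29 §3.5: the extremal family `(−1)^{|v|}·s(|v| mod 5)` has correlation `0.647·cos(π/30)^m`, so `m₀ ≥ 121` is forced and the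
rate form `CorrThirty` is false for huge `A`, ROUND-30 §5 F).  This is a CONJECTURE-TYPE TARGET of the cell, not a published fact: it is never
taken as a hypothesis silently — conditional results name it (`THM30B := CorrEta → …`).
WHAT THIS IS NOT: no theorem; separation NOT moved.
-/

namespace Summit.QuantumAdvantage.AdviceFreeQNC0.Frontier

open Finset

/-- The mod-5 value of the linear form `ℓ` on the 0/1 point `v`. -/
def formVal {m : ℕ} (ℓ : Fin m → ZMod 5) (v : Fin m → Bool) : ZMod 5 :=
  ∑ i, if v i then ℓ i else 0

/-- Number of passed tests `[ℓ_k · v ≡ c_k (mod 5)]`. -/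
def passed {m K : ℕ} (ℓ : Fin K → Fin m → ZMod 5) (c : Fin K → ZMod 5) (v : Fin m → Bool) : ℕ :=
  (univ.filter fun k => formVal (ℓ k) v = c k).card

/-- Hamming weight of `v`. -/
def hw {m : ℕ} (v : Fin m → Bool) : ℕ := (univ.filter fun i => v i = true).card

/-- The cubic character `ω^{b·|v|}` as a complex number. -/
noncomputable def cubeChar {m : ℕ} (b : ℕ) (v : Fin m → Bool) : ℂ :=
  Complex.exp (2 * Real.pi * Complex.I * ((b * hw v : ℕ) : ℂ) / 3)

/-- **(CORR-η)** — the frontier statement of the dense cruxes of route OddPrimeWalk (planner qa-qnc0-p2, ROUND-29 §3.5 / ROUND-30 §3;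
OPEN; typed only, never asserted): the parity of `K ≤ A·m` linear tests mod `5` on `{0,1}^m` has correlation `≤ η < 1/3` with every
non-trivial cubic character of the Hamming weight, for `m ≥ m₀(A)`. -/
def CorrEta : Prop :=
  ∀ A : ℕ, ∃ η : ℝ, η < 1 / 3 ∧ ∃ m₀ : ℕ, ∀ m ≥ m₀, ∀ K : ℕ, K ≤ A * m →
    ∀ (ℓ : Fin K → Fin m → ZMod 5) (c : Fin K → ZMod 5) (b : ℕ), b % 3 ≠ 0 →
      ‖∑ v : Fin m → Bool, ((-1 : ℂ) ^ passed ℓ c v) * cubeChar b v‖ ≤ η * (2 : ℝ) ^ m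

end Summit.QuantumAdvantage.AdviceFreeQNC0.Frontier
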